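import Mathlib
import HarnessLib
import Literature.NumberTheory.LFunctions.RiemannXi
import Literature.NumberTheory.LFunctions.RiemannXiLogDeriv
import Summits.RiemannHypothesis.RiemannHypothesis.Theorems.DeBrangesSuzukiDoorDefs
import Summits.RiemannHypothesis.RiemannHypothesis.Theorems.DeBrangesSuzukiDoorKernelSupportSymbolDecayUniform

/-!
# RiemannHypothesis / DeBrangesSuzukiDoor — crux `KernelSupport` (K3), stub `stub_lineIndependence`

Registered stub of the BC3 birth skeleton of `DeBrangesSuzukiDoor.KernelSupport` (stmt-RiemannHypothesis-19727;
planner rh-dbr-theory g4, `KernelSupport_line_birth.lean` sha16 6b04a5da75418a33), proved BY NAME with the registered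
signature (namespace `…Cruxes.KernelSupport.Birth`): for `θ > 10`, `b ≥ 1` and every real `x`,
`invFL Θ_θ b x = invFL Θ_θ 1 x` — the inverse transform does not depend on the line.

Proof (RH-FREE): Cauchy's theorem on the rectangles `[−R, R] × [1, b]` for `F(z) = Θ_θ(z) e^{−izx}`, holomorphic on
`Im z > 1/2` (there `Re(½ − iz) > 1`, so `ξ ≠ 0`: `riemannXi_ne_zero_of_one_le_re`; `ξ` entire); the vertical sides
tend to `0` by the uniform decay `stub_symbolDecayUniform`, the horizontal sides to the line integrals
(`intervalIntegral_tendsto_integral`, integrability from the same decay, `θ/10 > 1`).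
Nothing here bears on the truth of RH.
-/

noncomputable section

-- D-0017: `Summit.<S>.<S>.…` is the designed namespace of a single-problem summit.
set_option linter.dupNamespace false

open MeasureTheory Complex Filter Topology Set intervalIntegral

namespace Summit.RiemannHypothesis.RiemannHypothesis.Cruxes.KernelSupport.Birth

open Literature.NumberTheory.LFunctions

/-- RH-FREE: `Θ_θ` is holomorphic on `Im z > 1/2` (`ξ ≠ 0` on `Re s ≥ 1`, `ξ` entire). -/
theorem differentiableOn_thetaSym (θ : ℝ) : DifferentiableOn ℂ (thetaSym θ) {z : ℂ | 1 / 2 < z.im} := by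
  have hξa : AnalyticOnNhd ℂ riemannXi Set.univ :=
    differentiable_riemannXi.differentiableOn.analyticOnNhd isOpen_univ
  have hdξ : Differentiable ℂ (deriv riemannXi) := fun z => (hξa.deriv z (Set.mem_univ z)).differentiableAt
  intro z hz
  have hz' : 1 / 2 < z.im := hz
  have hg : DifferentiableAt ℂ (fun w : ℂ => (1 : ℂ) / 2 - I * w) z := by fun_prop
  have hne : riemannXi ((1 : ℂ) / 2 - I * z) ≠ 0 :=
    riemannXi_ne_zero_of_one_le_re (by simp; linarith)
  have h1 : DifferentiableAt ℂ (fun w => deriv riemannXi ((1 : ℂ) / 2 - I * w)) z := (hdξ _).comp z hg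
  have h2 : DifferentiableAt ℂ (fun w => riemannXi ((1 : ℂ) / 2 - I * w)) z := (differentiable_riemannXi _).comp z hg
  have h3 : DifferentiableAt ℂ (fun w => Complex.exp (-2 * (θ : ℂ) *
      (deriv riemannXi ((1 : ℂ) / 2 - I * w) / riemannXi ((1 : ℂ) / 2 - I * w)))) z :=
    ((h1.div h2 hne).const_mul _).cexp
  exact h3.differentiableWithinAt

/-- Continuity of `u ↦ Θ_θ(u + ic)` for `c ≥ 1` (K3-namespace copy). -/
theorem continuous_thetaSym_line (θ : ℝ) {c : ℝ} (hc : 1 ≤ c) :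
    Continuous (fun u : ℝ => thetaSym θ ((u : ℂ) + (c : ℂ) * I)) := by
  have hline : Continuous (fun u : ℝ => (u : ℂ) + (c : ℂ) * I) := by fun_prop
  have hd := differentiableOn_thetaSym θ
  refine continuous_iff_continuousAt.2 fun u => ?_
  have hmem : (u : ℂ) + (c : ℂ) * I ∈ {z : ℂ | 1 / 2 < z.im} := by
    show 1 / 2 < ((u : ℂ) + (c : ℂ) * I).im
    simp; linarith
  have hopen : IsOpen {z : ℂ | 1 / 2 < z.im} := isOpen_lt continuous_const Complex.continuous_im
  have h1 : ContinuousAt (thetaSym θ) ((u : ℂ) + (c : ℂ) * I) :=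
    ((hd _ hmem).differentiableAt (hopen.mem_nhds hmem)).continuousAt
  exact ContinuousAt.comp (g := thetaSym θ) (f := fun u : ℝ => (u : ℂ) + (c : ℂ) * I) h1 hline.continuousAt

/-- `|e^{−i(u+iy)x}| = e^{yx}`. -/
lemma norm_exp_neg_I_mul (u y x : ℝ) :
    ‖Complex.exp (-I * ((u : ℂ) + (y : ℂ) * I) * (x : ℂ))‖ = Real.exp (y * x) := by
  rw [Complex.norm_exp]
  congr 1
  simp only [Complex.mul_re, Complex.mul_im, Complex.neg_re, Complex.neg_im, Complex.add_re,
    Complex.add_im, Complex.I_re, Complex.I_im, Complex.ofReal_re, Complex.ofReal_im]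
  ring

/-- **Registered stub `stub_lineIndependence` of crux `KernelSupport` (PROVED, RH-FREE).** -/
theorem stub_lineIndependence : ∀ θ : ℝ, 10 < θ → ∀ b : ℝ, 1 ≤ b → ∀ x : ℝ,
    invFL (thetaSym θ) b x = invFL (thetaSym θ) 1 x := by
  intro θ hθ b hb x
  obtain ⟨C, hC⟩ := stub_symbolDecayUniform θ hθ
  set F : ℂ → ℂ := fun z => thetaSym θ z * Complex.exp (-I * z * (x : ℂ)) with hF
  -- holomorphy on Im z > 1/2
  have hFd : DifferentiableOn ℂ F {z : ℂ | 1 / 2 < z.im} :=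
    (differentiableOn_thetaSym θ).mul (by fun_prop)
  -- pointwise bound on lines Im z = y ≥ 1
  have hbound : ∀ y : ℝ, 1 ≤ y → ∀ u : ℝ,
      ‖F ((u : ℂ) + (y : ℂ) * I)‖ ≤ C * (1 + |u|) ^ (-(θ / 10)) * Real.exp (y * x) := by
    intro y hy u
    simp only [hF, norm_mul, norm_exp_neg_I_mul]
    exact mul_le_mul_of_nonneg_right (hC y hy u) (Real.exp_pos _).le
  have hC0 : 0 ≤ C := by
    have h := hC 1 le_rfl 0
    have : (0 : ℝ) ≤ C * (1 + |(0 : ℝ)|) ^ (-(θ / 10)) := (norm_nonneg _).trans h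
    simpa using this
  -- integrability on each line y ≥ 1
  have hInt : ∀ y : ℝ, 1 ≤ y → Integrable (fun u : ℝ => F ((u : ℂ) + (y : ℂ) * I)) := by
    intro y hy
    have hmaj : Integrable (fun u : ℝ => C * Real.exp (y * x) * (1 + ‖u‖) ^ (-(θ / 10))) :=
      (integrable_one_add_norm (E := ℝ) (μ := volume) (r := θ / 10) (by simp; linarith)).const_mul _
    have hcont : Continuous (fun u : ℝ => F ((u : ℂ) + (y : ℂ) * I)) := by
      simp only [hF]
      exact (continuous_thetaSym_line θ hy).mul (by fun_prop)
    refine hmaj.mono' hcont.aestronglyMeasurable (Eventually.of_forall fun u => ?_)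
    have h := hbound y hy u
    rw [Real.norm_eq_abs]
    calc ‖F ((u : ℂ) + (y : ℂ) * I)‖ ≤ C * (1 + |u|) ^ (-(θ / 10)) * Real.exp (y * x) := h
      _ = C * Real.exp (y * x) * (1 + |u|) ^ (-(θ / 10)) := by ring
  -- Cauchy on the rectangle [-R, R] × [1, b]
  have hrect : ∀ R : ℝ, (∫ u in -R..R, F ((u : ℂ) + ((1 : ℝ) : ℂ) * I)) - (∫ u in -R..R, F ((u : ℂ) + (b : ℂ) * I))
      + I • (∫ y in (1 : ℝ)..b, F ((R : ℂ) + (y : ℂ) * I)) - I • (∫ y in (1 : ℝ)..b, F (((-R : ℝ) : ℂ) + (y : ℂ) * I)) = 0 := by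
    intro R
    have him1 : (((-R : ℝ) : ℂ) + ((1 : ℝ) : ℂ) * I).im = 1 := by simp
    have him2 : ((R : ℂ) + (b : ℂ) * I).im = b := by simp
    have hsub : (Set.uIcc (((-R : ℝ) : ℂ) + ((1 : ℝ) : ℂ) * I).re ((R : ℂ) + (b : ℂ) * I).re ×ℂ
        Set.uIcc (((-R : ℝ) : ℂ) + ((1 : ℝ) : ℂ) * I).im ((R : ℂ) + (b : ℂ) * I).im) ⊆ {z : ℂ | 1 / 2 < z.im} := by
      intro z hz
      have hz2 := hz.2
      rw [him1, him2, Set.mem_preimage, Set.uIcc_of_le hb] at hz2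
      show 1 / 2 < z.im
      linarith [hz2.1]
    have h := integral_boundary_rect_eq_zero_of_differentiableOn F (((-R : ℝ) : ℂ) + ((1 : ℝ) : ℂ) * I)
      ((R : ℂ) + (b : ℂ) * I) (hFd.mono hsub)
    simpa using h
  -- vertical sides → 0
  have hvert : ∀ s : ℝ → ℝ, Tendsto (fun R : ℝ => |s R|) atTop atTop →
      Tendsto (fun R : ℝ => ∫ y in (1 : ℝ)..b, F (((s R : ℝ) : ℂ) + (y : ℂ) * I)) atTop (𝓝 0) := by
    intro s hs
    rw [tendsto_zero_iff_norm_tendsto_zero]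
    have hmaj : ∀ R : ℝ, ‖∫ y in (1 : ℝ)..b, F (((s R : ℝ) : ℂ) + (y : ℂ) * I)‖ ≤
        C * Real.exp (b * |x|) * |b - 1| * (1 + |s R|) ^ (-(θ / 10)) := by
      intro R
      have h1 : ‖∫ y in (1 : ℝ)..b, F (((s R : ℝ) : ℂ) + (y : ℂ) * I)‖ ≤
          C * (1 + |s R|) ^ (-(θ / 10)) * Real.exp (b * |x|) * |b - 1| := by
        refine norm_integral_le_of_norm_le_const fun y hy => ?_
        rw [Set.uIoc_of_le hb] at hy
        have hy1 : 1 ≤ y := le_of_lt hy.1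
        have hyx : y * x ≤ b * |x| := by
          have : y * x ≤ y * |x| := mul_le_mul_of_nonneg_left (le_abs_self x) (by linarith)
          have : y * |x| ≤ b * |x| := mul_le_mul_of_nonneg_right hy.2 (abs_nonneg x)
          linarith
        calc ‖F (((s R : ℝ) : ℂ) + (y : ℂ) * I)‖ ≤ C * (1 + |s R|) ^ (-(θ / 10)) * Real.exp (y * x) := hbound y hy1 (s R)
          _ ≤ C * (1 + |s R|) ^ (-(θ / 10)) * Real.exp (b * |x|) := by
              gcongr
      linarith [h1, show C * (1 + |s R|) ^ (-(θ / 10)) * Real.exp (b * |x|) * |b - 1| =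
        C * Real.exp (b * |x|) * |b - 1| * (1 + |s R|) ^ (-(θ / 10)) from by ring]
    have hlim : Tendsto (fun R : ℝ => C * Real.exp (b * |x|) * |b - 1| * (1 + |s R|) ^ (-(θ / 10))) atTop (𝓝 0) := by
      have h1 : Tendsto (fun R : ℝ => 1 + |s R|) atTop atTop := tendsto_atTop_add_const_left _ _ hs
      have h2 := (tendsto_rpow_neg_atTop (by linarith : 0 < θ / 10)).comp h1
      simpa using h2.const_mul (C * Real.exp (b * |x|) * |b - 1|)
    exact squeeze_zero (fun R => norm_nonneg _) hmaj hlim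
  have hvR := hvert (fun R => R) (by simpa using tendsto_abs_atTop_atTop)
  have hvL := hvert (fun R => -R) (by simp only [abs_neg]; exact tendsto_abs_atTop_atTop)
  -- horizontal sides → line integrals
  have hh1 := intervalIntegral_tendsto_integral (hInt 1 le_rfl) tendsto_neg_atTop_atBot tendsto_id
  have hhb := intervalIntegral_tendsto_integral (hInt b hb) tendsto_neg_atTop_atBot tendsto_id
  -- combine
  have hcomb : Tendsto (fun R : ℝ => (∫ u in -R..R, F ((u : ℂ) + ((1 : ℝ) : ℂ) * I)) - (∫ u in -R..R, F ((u : ℂ) + (b : ℂ) * I))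
      + I • (∫ y in (1 : ℝ)..b, F ((R : ℂ) + (y : ℂ) * I)) - I • (∫ y in (1 : ℝ)..b, F (((-R : ℝ) : ℂ) + (y : ℂ) * I)))
      atTop (𝓝 ((∫ u : ℝ, F ((u : ℂ) + ((1 : ℝ) : ℂ) * I)) - (∫ u : ℝ, F ((u : ℂ) + (b : ℂ) * I)) + I • 0 - I • 0)) :=
    ((hh1.sub hhb).add (hvR.const_smul I)).sub (hvL.const_smul I)
  have hzero : Tendsto (fun R : ℝ => (∫ u in -R..R, F ((u : ℂ) + ((1 : ℝ) : ℂ) * I)) - (∫ u in -R..R, F ((u : ℂ) + (b : ℂ) * I))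
      + I • (∫ y in (1 : ℝ)..b, F ((R : ℂ) + (y : ℂ) * I)) - I • (∫ y in (1 : ℝ)..b, F (((-R : ℝ) : ℂ) + (y : ℂ) * I)))
      atTop (𝓝 0) := by
    have : (fun R : ℝ => (∫ u in -R..R, F ((u : ℂ) + ((1 : ℝ) : ℂ) * I)) - (∫ u in -R..R, F ((u : ℂ) + (b : ℂ) * I))
      + I • (∫ y in (1 : ℝ)..b, F ((R : ℂ) + (y : ℂ) * I)) - I • (∫ y in (1 : ℝ)..b, F (((-R : ℝ) : ℂ) + (y : ℂ) * I))) =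
        fun _ => 0 := funext hrect
    rw [this]; exact tendsto_const_nhds
  have heq := tendsto_nhds_unique hcomb hzero
  simp only [smul_zero, add_zero, sub_zero] at heq
  -- conclude
  unfold invFL
  congr 1
  have e1 : (∫ u : ℝ, thetaSym θ ((u : ℂ) + (b : ℂ) * I) * Complex.exp (-I * ((u : ℂ) + (b : ℂ) * I) * (x : ℂ))) =
      ∫ u : ℝ, F ((u : ℂ) + (b : ℂ) * I) := rfl
  have e2 : (∫ u : ℝ, thetaSym θ ((u : ℂ) + ((1 : ℝ) : ℂ) * I) * Complex.exp (-I * ((u : ℂ) + ((1 : ℝ) : ℂ) * I) * (x : ℂ))) =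
      ∫ u : ℝ, F ((u : ℂ) + ((1 : ℝ) : ℂ) * I) := rfl
  rw [e1, e2]
  exact (sub_eq_zero.1 heq).symm

end Summit.RiemannHypothesis.RiemannHypothesis.Cruxes.KernelSupport.Birth

end
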